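import Summits.HodgeConjecture.CorCM.ParallelShadowsCapacity
import HarnessLib

/-!
# RELATIVE PAIR FLIPS, I: the kernel of an equivariant map `ℚ^Y → ℚ^X` through a relative pair flip, and parallel
# shadows as constant unequal multiplicities

COR-CM (cell `pub-hodgecm2`, binder seat `b16` gen 52, count-neutral claim TOWER-SHADOW, file F1 — abstract `G`-set
level; theorems only, no definition, no named fact, no `sorry`).  NEW as stated, hence under `Summits/`.  HONEST FRAMING:
finite-dimensional linear algebra about the Kubota–Dodson rank of CM types; `HC_CM` is neither used nor asserted.

SETTING (tree notation of `Literature.NumberTheory.ComplexMultiplication.CMTypeRank*` and seat b16 gen 49's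
`ParallelShadowsSlots`).  A group `G` acts on a BASE `G`-set `X` and a PARTNER `G`-set `Y`, `Φ₀ ⊆ X` and `Φ₁ ⊆ Y` are CM
types for a central involution `ρ`, and `r : Y → X` is EQUIVARIANT (for CM fields: `X = Hom(K₀, ℂ)`, `Y = Hom(K₁, ℂ)` for a
subfield `j : K₀ → K₁`, `r y = y ∘ j`).  The SHADOW of `Φ₁` on `X` is the fibre sum
`c₁(x) = Σ_{r y = x} u_1(Φ₁)(y) = 2·#(Φ₁ ∩ r⁻¹x) − #r⁻¹x` (Yanai's multiplicities, `Shadow.fibreSum_antiVec_one_eq`); the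
shadow of `Φ₀` on its own slot is its type vector `u_1(Φ₀) = ±1`.  A RELATIVE PAIR FLIP at `x₀ ∈ X` is a `σ ∈ G` with
`σ x₀ = ρ x₀` fixing every `y ∈ Y` OFF the two fibres `r⁻¹x₀`, `r⁻¹(ρx₀)` (with `r` surjective these are pair flips of
`X`, `pairFlip_of_relFlip`).

* §1 **`antiVec_one_eq_mul_fibreSum_of_collapse`** (the kernel computation).  `G` transitive on `X` and on `Y`, a relative
  pair flip at `x₀`: every `G`-equivariant `L : ℚ^Y → ℚ^X` with `L u_1(Φ₁) = u_1(Φ₀)` forces `u_1(Φ₀) = c · c₁` with `c ≠ 0`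
  — Frobenius reciprocity by hand: the invariant kernel `S(y, x) = (L δ_y)(x)` gives the functional
  `ℓ(y) = S(y, x₀) − S(y, ρx₀)`, constant on `r⁻¹x₀` (transitivity of `Stab x₀` on the fibre comes free from transitivity
  on `Y`), opposite on `r⁻¹(ρx₀)`, and ZERO elsewhere (the relative flip); pairing with the translates `u_g(Φ₁)` gives
  `2 u_1(Φ₀)(g x₀) = 2c · c₁(g x₀)`.
* §2 **`parallel_iff_exists_multiplicities`**: the shadow of `Φ₁` is a multiple of `u_1(Φ₀)` iff `Φ₁` lies over `Φ₀` with
  CONSTANT MULTIPLICITIES `(a, b)`, `a ≠ b` — Yanai's condition `π(Σ_{σ∈S} σ) = a Σ_{σ∈S₁} σ + b Σ_{σ∈S₁} σ̄` (Gordon 9.4.3)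
  with `S₁ = Φ₀` (the multiple is `1/(a − b)`).
Sequel (families, the exact criterion): `RelativePairFlipShadows`; number fields: `GenericCMSubfieldTowerHodge`.

## References

* [Gordon1999HodgeAVSurvey] B. B. Gordon, *A survey of the Hodge conjecture for abelian varieties*, §3 Theorem (Imai,
  Murty) with proof, 9.4.3 (Yanai's theorem on types lying over a subtype).
* [Serre1977] J.-P. Serre, *Linear Representations of Finite Groups*, GTM 42, §2.2 (Schur), §7.2 (Frobenius reciprocity).
* [Shimura1998] G. Shimura, *Abelian Varieties with Complex Multiplication and Modular Functions*, §32.10.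
* [Dodson1984] B. Dodson, *The structure of Galois groups of CM-fields*, Trans. AMS 283 (1984), §1.1, §5.1.2.
-/

set_option autoImplicit false

noncomputable section

open scoped BigOperators

universe u

namespace Summit.HodgeConjecture.CorCM.Shadow

open Literature.NumberTheory.ComplexMultiplication
open scoped Classical

variable {G : Type u} [Group G]

/-! ### §1 The kernel of a collapse map through a relative pair flip -/

section Kernel

variable {X Y : Type*} [MulAction G X] [MulAction G Y] [Fintype X] [Fintype Y]

omit [Fintype X] [Fintype Y] in
/-- The type vector `u_g(Ψ)` takes the values `±1`, in particular it never vanishes. [folklore] -/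
theorem antiVec_ne_zero (Ψ : Set X) (g : G) (x : X) : antiVec Ψ g x ≠ 0 := by
  simp only [antiVec]
  by_cases hx : g • x ∈ Ψ
  · rw [translateInd_of_mem hx]; norm_num
  · rw [translateInd_of_not_mem hx]; norm_num

omit [Fintype X] [Fintype Y] in
/-- `u_1(Ψ)(x) = 1` on `Ψ` and `= −1` off `Ψ`. [folklore] -/
theorem antiVec_one_eq_ite (Ψ : Set X) (x : X) : antiVec Ψ (1 : G) x = if x ∈ Ψ then (1 : ℚ) else -1 := by
  simp only [antiVec]
  by_cases hx : x ∈ Ψ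
  · rw [if_pos hx, translateInd_of_mem (by rwa [one_smul])]; norm_num
  · rw [if_neg hx, translateInd_of_not_mem (by rwa [one_smul])]; norm_num

omit [Fintype X] in
/-- **Fibre sums reindex along the action**: `Σ_{r y = x} f(g • y) = Σ_{r y = g • x} f(y)` for an equivariant `r`.
[folklore] -/
theorem fibreSum_comp_smul (r : Y → X) (hr : ∀ (g : G) (y : Y), r (g • y) = g • r y) (f : Y → ℚ) (g : G) (x : X) :
    ∑ y ∈ Finset.univ.filter (fun y : Y => r y = x), f (g • y) =
      ∑ y ∈ Finset.univ.filter (fun y : Y => r y = g • x), f y := by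
  refine Finset.sum_nbij' (fun y => g • y) (fun y => g⁻¹ • y) ?_ ?_ ?_ ?_ ?_
  · intro y hy
    simp only [Finset.mem_filter, Finset.mem_univ, true_and] at hy ⊢
    rw [hr, hy]
  · intro y hy
    simp only [Finset.mem_filter, Finset.mem_univ, true_and] at hy ⊢
    rw [hr, hy, inv_smul_smul]
  · intro y _
    exact inv_smul_smul g y
  · intro y _
    exact smul_inv_smul g y
  · intro y _
    rfl

omit [Fintype X] in
/-- **Fibre cardinalities are constant along the action**: `#r⁻¹(g • x) = #r⁻¹(x)`. [folklore] -/
theorem card_fibre_smul (r : Y → X) (hr : ∀ (g : G) (y : Y), r (g • y) = g • r y) (g : G) (x : X) :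
    (Finset.univ.filter fun y : Y => r y = g • x).card = (Finset.univ.filter fun y : Y => r y = x).card := by
  symm
  refine Finset.card_equiv (MulAction.toPerm g) fun y => ?_
  simp only [Finset.mem_filter, Finset.mem_univ, true_and, MulAction.toPerm_apply, hr]
  exact ⟨fun h => by rw [h], fun h => smul_left_cancel g h⟩

omit [Fintype X] [Fintype Y] in
/-- **Relative pair flips are pair flips of the base** when `r` is surjective: a `σ` with `σ x = ρ x` fixing every
point of `Y` off the fibres of `x`, `ρ x` fixes every `x' ∉ {x, ρ x}` (`x' = r y` with `σ y = y`). [folklore] -/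
theorem pairFlip_of_relFlip {ρ : G} (r : Y → X) (hr : ∀ (g : G) (y : Y), r (g • y) = g • r y)
    (hsurj : Function.Surjective r)
    (hflip : ∀ x : X, ∃ σ : G, σ • x = ρ • x ∧ ∀ y : Y, r y ≠ x → r y ≠ ρ • x → σ • y = y) (x : X) :
    ∃ φ : G, φ • x = ρ • x ∧ ∀ x' : X, x' ≠ x → x' ≠ ρ • x → φ • x' = x' := by
  obtain ⟨σ, hσx, hσ⟩ := hflip x
  refine ⟨σ, hσx, fun x' h1 h2 => ?_⟩
  obtain ⟨y, rfl⟩ := hsurj x'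
  rw [← hr, hσ y h1 h2]

omit [Fintype X] in
/-- **The kernel computation.**  `G` transitive on `X` and on `Y`, `r : Y → X` equivariant, `Φ₀ ⊆ X` and `Φ₁ ⊆ Y` CM
types for `ρ`, a RELATIVE PAIR FLIP at `x₀` (`σ x₀ = ρ x₀`, `σ y = y` whenever `r y ∉ {x₀, ρ x₀}`).  Then every
`G`-equivariant `L : ℚ^Y → ℚ^X` with `L u_1(Φ₁) = u_1(Φ₀)` makes the shadow of `Φ₁` PARALLEL to `u_1(Φ₀)`:
`u_1(Φ₀)(x) = c · Σ_{r y = x} u_1(Φ₁)(y)` with `c ≠ 0`.  (The functional `ℓ(y) = (Lδ_y)(x₀) − (Lδ_y)(ρx₀)` is constant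
`c` on `r⁻¹x₀`, `−c` on `r⁻¹(ρx₀)` and `0` elsewhere; pair it with the translates of `u_1(Φ₁)`.)
[cite: Serre1977, §7.2] [cite: Gordon1999HodgeAVSurvey, §3 Theorem (proof)] -/
theorem antiVec_one_eq_mul_fibreSum_of_collapse [MulAction.IsPretransitive G X] [MulAction.IsPretransitive G Y]
    [Nonempty Y] {ρ : G} {Φ₀ : Set X} {Φ₁ : Set Y} (h₀ : IsCMTypeWith ρ Φ₀) (h₁ : IsCMTypeWith ρ Φ₁) (r : Y → X)
    (hr : ∀ (g : G) (y : Y), r (g • y) = g • r y) {x₀ : X}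
    (hflip : ∃ σ : G, σ • x₀ = ρ • x₀ ∧ ∀ y : Y, r y ≠ x₀ → r y ≠ ρ • x₀ → σ • y = y)
    (L : (Y → ℚ) →ₗ[ℚ] (X → ℚ)) (hL : ∀ (g : G) (f : Y → ℚ), L (fun y => f (g • y)) = fun x => L f (g • x))
    (hLu : L (antiVec Φ₁ (1 : G)) = antiVec Φ₀ (1 : G)) :
    ∃ c : ℚ, c ≠ 0 ∧ ∀ x : X, antiVec Φ₀ (1 : G) x =
      c * ∑ y ∈ Finset.univ.filter (fun y : Y => r y = x), antiVec Φ₁ (1 : G) y := by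
  -- the invariant kernel `S y x = (L δ_y)(x)`
  set S : Y → X → ℚ := fun y x => L (Pi.single y 1) x with hSdef
  have hSinv : ∀ (g : G) (y : Y) (x : X), S (g • y) (g • x) = S y x := by
    intro g y x
    have h1 : (fun y' => (Pi.single (g • y) (1 : ℚ) : Y → ℚ) (g • y')) = Pi.single y 1 := by
      funext y'
      by_cases hy : y' = y
      · rw [hy, Pi.single_eq_same, Pi.single_eq_same]
      · rw [Pi.single_eq_of_ne hy, Pi.single_eq_of_ne (fun h => hy (smul_left_cancel g h))]
    have h2 := hL g (Pi.single (g • y) 1)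
    rw [h1] at h2
    exact (congrFun h2 x).symm
  -- expansion of `(L f)(x)` along the kernel
  have hexp : ∀ (f : Y → ℚ) (x : X), L f x = ∑ y, f y * S y x := by
    intro f x
    have hf : f = ∑ y, f y • (Pi.single y (1 : ℚ) : Y → ℚ) := by
      funext y'
      rw [Finset.sum_apply]
      simp only [Pi.smul_apply, Pi.single_apply, smul_eq_mul, mul_ite, mul_one, mul_zero]
      rw [Finset.sum_ite_eq Finset.univ y' f, if_pos (Finset.mem_univ _)]
    conv_lhs => rw [hf]
    rw [map_sum, Finset.sum_apply]
    refine Finset.sum_congr rfl fun y _ => ?_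
    rw [map_smul, Pi.smul_apply, smul_eq_mul]
  -- the functional `ℓ(y) = S y x₀ − S y (ρ x₀)`: constant on `r⁻¹ x₀`, zero off the two fibres, odd under `ρ`
  have hfib : ∀ y y' : Y, r y = x₀ → r y' = x₀ →
      S y x₀ - S y (ρ • x₀) = S y' x₀ - S y' (ρ • x₀) := by
    intro y y' hy hy'
    obtain ⟨g, hg⟩ := MulAction.exists_smul_eq G y y'
    have hgx : g • x₀ = x₀ := by rw [← hy, ← hr, hg, hy', hy]
    rw [← hSinv g y x₀, ← hSinv g y (ρ • x₀), hg, h₀.comm g x₀, hgx]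
  have hoff : ∀ y : Y, r y ≠ x₀ → r y ≠ ρ • x₀ → S y x₀ - S y (ρ • x₀) = 0 := by
    intro y hy hy'
    obtain ⟨σ, hσx, hσ⟩ := hflip
    have hσy := hσ y hy hy'
    have h1 : S y x₀ = S y (ρ • x₀) := by rw [← hSinv σ y x₀, hσy, hσx]
    rw [h1, sub_self]
  have hopp : ∀ y : Y, S y x₀ - S y (ρ • x₀) = -(S (ρ • y) x₀ - S (ρ • y) (ρ • x₀)) := by
    intro y
    rw [← hSinv ρ y x₀, ← hSinv ρ y (ρ • x₀), h₀.invol]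
    ring
  -- a base point of `r⁻¹ x₀` and the constant `c`
  obtain ⟨y₁⟩ := ‹Nonempty Y›
  obtain ⟨g₁, hg₁⟩ := MulAction.exists_smul_eq G (r y₁) x₀
  have hy₀ : r (g₁ • y₁) = x₀ := by rw [hr, hg₁]
  set c : ℚ := S (g₁ • y₁) x₀ - S (g₁ • y₁) (ρ • x₀) with hcdef
  have hx₀ρ : ρ • x₀ ≠ x₀ := h₀.rho_smul_ne x₀
  have hℓval : ∀ y : Y, S y x₀ - S y (ρ • x₀) =
      c * ((if r y = x₀ then (1 : ℚ) else 0) - if r y = ρ • x₀ then (1 : ℚ) else 0) := by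
    intro y
    by_cases hy1 : r y = x₀
    · rw [if_pos hy1, if_neg (by rw [hy1]; exact hx₀ρ.symm), sub_zero, mul_one]
      exact hfib y _ hy1 hy₀
    · by_cases hy2 : r y = ρ • x₀
      · rw [if_neg hy1, if_pos hy2, zero_sub, mul_neg, mul_one, hopp y]
        have h3 : r (ρ • y) = x₀ := by rw [hr, hy2, h₀.invol]
        rw [hfib (ρ • y) _ h3 hy₀]
      · rw [if_neg hy1, if_neg hy2, sub_zero, mul_zero]
        exact hoff y hy1 hy2
  -- pair `ℓ` with the translates of `u_1(Φ₁)`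
  have hodd₀ : ∀ x : X, antiVec Φ₀ (1 : G) (ρ • x) = -antiVec Φ₀ (1 : G) x := fun x =>
    (mem_antiWeights_iff'.1 (antiVec_mem_antiWeights h₀ 1)) x
  have key : ∀ g : G, 2 * antiVec Φ₀ (1 : G) (g • x₀) =
      2 * (c * ∑ y ∈ Finset.univ.filter (fun y : Y => r y = g • x₀), antiVec Φ₁ (1 : G) y) := by
    intro g
    have hLg : L (fun y => antiVec Φ₁ (1 : G) (g • y)) = fun x => antiVec Φ₀ (1 : G) (g • x) := by
      rw [hL g, hLu]
    -- left-hand side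
    have lhs : L (fun y => antiVec Φ₁ (1 : G) (g • y)) x₀ - L (fun y => antiVec Φ₁ (1 : G) (g • y)) (ρ • x₀) =
        2 * antiVec Φ₀ (1 : G) (g • x₀) := by
      rw [hLg]
      show antiVec Φ₀ (1 : G) (g • x₀) - antiVec Φ₀ (1 : G) (g • ρ • x₀) = _
      rw [h₀.comm g x₀, hodd₀]
      ring
    -- right-hand side through the kernel
    have rhs : L (fun y => antiVec Φ₁ (1 : G) (g • y)) x₀ - L (fun y => antiVec Φ₁ (1 : G) (g • y)) (ρ • x₀) =
        c * ((∑ y, (if r y = x₀ then (1 : ℚ) else 0) * antiVec Φ₁ (1 : G) (g • y)) -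
          ∑ y, (if r y = ρ • x₀ then (1 : ℚ) else 0) * antiVec Φ₁ (1 : G) (g • y)) := by
      rw [hexp _ x₀, hexp _ (ρ • x₀), ← Finset.sum_sub_distrib, mul_sub, Finset.mul_sum, Finset.mul_sum,
        ← Finset.sum_sub_distrib]
      refine Finset.sum_congr rfl fun y _ => ?_
      rw [← mul_sub, hℓval y]
      ring
    rw [sum_fibreInd_mul_eq, sum_fibreInd_mul_eq, fibreSum_comp_smul r hr _ g x₀,
      fibreSum_comp_smul r hr _ g (ρ • x₀), h₀.comm g x₀, fibreSum_antiVec_one_rho_smul h₁ hr (g • x₀)] at rhs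
    rw [← lhs, rhs]
    ring
  -- conclusion
  have hc0 : c ≠ 0 := by
    intro h0
    have h := key 1
    rw [h0, zero_mul, mul_zero, one_smul] at h
    exact antiVec_ne_zero Φ₀ (1 : G) x₀ (by linarith)
  refine ⟨c, hc0, fun x => ?_⟩
  obtain ⟨g, rfl⟩ := MulAction.exists_smul_eq G x₀ x
  have h := key g
  linarith

/-! ### §2 Parallel shadows are constant unequal multiplicities -/

omit [Fintype X] in
/-- **Parallel shadow ⟺ constant unequal multiplicities.**  `G` transitive on `X`, `r : Y → X` equivariant, `Φ₀`, `Φ₁`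
CM types for `ρ`: the shadow of `Φ₁` is a rational multiple of `u_1(Φ₀)` iff `Φ₁` lies over `Φ₀` with CONSTANT
MULTIPLICITIES — `a` points of `Φ₁` over every `x ∈ Φ₀`, `b` over every `x ∉ Φ₀` — and `a ≠ b` (Yanai's condition with
`S₁ = Φ₀`; the multiple is `1/(a − b)`). [cite: Gordon1999HodgeAVSurvey, 9.4.3] -/
theorem parallel_iff_exists_multiplicities [MulAction.IsPretransitive G X] [Nonempty X] {ρ : G} {Φ₀ : Set X}
    {Φ₁ : Set Y} (h₀ : IsCMTypeWith ρ Φ₀) (h₁ : IsCMTypeWith ρ Φ₁) (r : Y → X)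
    (hr : ∀ (g : G) (y : Y), r (g • y) = g • r y) :
    (∃ c : ℚ, ∀ x : X, antiVec Φ₀ (1 : G) x =
        c * ∑ y ∈ Finset.univ.filter (fun y : Y => r y = x), antiVec Φ₁ (1 : G) y) ↔
      ∃ a b : ℕ, a ≠ b ∧ ∀ x : X,
        (Finset.univ.filter fun y : Y => r y = x ∧ y ∈ Φ₁).card = if x ∈ Φ₀ then a else b := by
  constructor
  · rintro ⟨c, hc⟩
    -- a base point inside `Φ₀`
    obtain ⟨x'⟩ := ‹Nonempty X›
    obtain ⟨x₁, hx₁⟩ : ∃ x₁ : X, x₁ ∈ Φ₀ := by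
      by_cases hx' : x' ∈ Φ₀
      · exact ⟨x', hx'⟩
      · exact ⟨ρ • x', (h₀.rho_smul_mem_iff x').2 hx'⟩
    have hρx₁ : ρ • x₁ ∉ Φ₀ := (h₀.mem_iff x₁).1 hx₁
    -- fibre cardinalities are constant
    have hm : ∀ x : X, ((Finset.univ.filter fun y : Y => r y = x).card : ℚ) =
        (Finset.univ.filter fun y : Y => r y = x₁).card := by
      intro x
      obtain ⟨g, rfl⟩ := MulAction.exists_smul_eq G x₁ x
      rw [card_fibre_smul r hr g x₁]
    -- the relation at `x`, in counts
    have hrel : ∀ x : X, (if x ∈ Φ₀ then (1 : ℚ) else -1) =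
        c * (2 * ((Finset.univ.filter fun y : Y => r y = x ∧ y ∈ Φ₁).card : ℚ) -
          (Finset.univ.filter fun y : Y => r y = x₁).card) := by
      intro x
      rw [← antiVec_one_eq_ite (G := G) Φ₀ x, hc x, fibreSum_antiVec_one_eq, hm x]
    have hc0 : c ≠ 0 := by
      intro h0
      have h := hrel x₁
      rw [if_pos hx₁, h0, zero_mul] at h
      exact one_ne_zero h
    refine ⟨(Finset.univ.filter fun y : Y => r y = x₁ ∧ y ∈ Φ₁).card,
      (Finset.univ.filter fun y : Y => r y = ρ • x₁ ∧ y ∈ Φ₁).card, fun hab => ?_, fun x => ?_⟩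
    · have h1 := hrel x₁
      have h2 := hrel (ρ • x₁)
      rw [if_pos hx₁] at h1
      rw [if_neg hρx₁, ← hab] at h2
      linarith
    · by_cases hx : x ∈ Φ₀
      · rw [if_pos hx]
        have h1 := hrel x
        have h2 := hrel x₁
        rw [if_pos hx] at h1
        rw [if_pos hx₁] at h2
        have h3 := h1.symm.trans h2
        have h4 := mul_left_cancel₀ hc0 h3
        exact_mod_cast (by linarith : ((Finset.univ.filter fun y : Y => r y = x ∧ y ∈ Φ₁).card : ℚ) =
          (Finset.univ.filter fun y : Y => r y = x₁ ∧ y ∈ Φ₁).card)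
      · rw [if_neg hx]
        have h1 := hrel x
        have h2 := hrel (ρ • x₁)
        rw [if_neg hx] at h1
        rw [if_neg hρx₁] at h2
        have h3 := h1.symm.trans h2
        have h4 := mul_left_cancel₀ hc0 h3
        exact_mod_cast (by linarith : ((Finset.univ.filter fun y : Y => r y = x ∧ y ∈ Φ₁).card : ℚ) =
          (Finset.univ.filter fun y : Y => r y = ρ • x₁ ∧ y ∈ Φ₁).card)
  · rintro ⟨a, b, hab, hmult⟩
    have hq : ((a : ℚ) - b) ≠ 0 := sub_ne_zero.2 (Nat.cast_injective.ne hab)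
    refine ⟨1 / ((a : ℚ) - b), fun x => ?_⟩
    rw [fibreSum_antiVec_one_eq_of_multiplicities hr h₁ h₀ hmult x, antiVec_one_eq_ite]
    split_ifs
    · field_simp
    · field_simp
      ring

end Kernel

end Summit.HodgeConjecture.CorCM.Shadow

end
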